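import Literature.Geometry.ComplexHyperbolic.UnitBallRegularOrbitSupportBound   -- ★ p844013 (p05 (g14)): corner entry, `|g₂₀|² + |g₂₁|² = |g₂₂|² − 1`, the D-regime bound; brings ★ (β-0) `mat_conj_diagonal_eq_sum`, ★ `UnitBallBounds`
import HarnessLib

/-!
# The ONE-LEVEL support bound for regular orbital integrals of `U(2,1)` in ALL regimes: `(|g₂₂|² − 1)·min(|z₂−z₀|,|z₂−z₁|)² ≤ |(g·diag z·g⁻¹)₂₀|² + |(g·diag z·g⁻¹)₂₁|²`
# (ROAD A, design «(A6) IN-HOUSE» v2 §2 brick (c1) = Warner II, Appendix to 8.4.3, Lemma 2 for `U(2,1)` with exponent 2; Rogawski 1990 §8.4; Goldman 1999 §3.1.1)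

Topic `Geometry/ComplexHyperbolic`; namespace `Literature.Geometry.ComplexHyperbolic.BallModel`.  THEOREMS ONLY (no `def`, no instance, no notation, no axiom, no named fact, no `sorry`).
Cell `pub/hodgecm-mathlib`, ENGINE T1 (crux H413 = `stmt-HodgeConjecture-24833`); ROAD A (N1 = `stub_L21` ∕ «SdArch» `stub_A6`), design `DESIGN-A6-InHouse-v2-ArchitectureIV` 93542b84 (★1):
the crude, polynomial-loss compactness estimate that Harish-Chandra's bootstrap (Warner II Thm. 8.4.3.1) starts from, now valid on ALL six chambers; author F0P3a-p05 (g15) (ROAD A owner), 2026-09-01.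

THE MATHEMATICS.  For `g ∈ G = U(2,1)` (`J = diag(1,1,−1)`, columns `c_p(g)` `J`-orthonormal) and `t = diag(z₀,z₁,z₂)` the spectral form ★ `mat_conj_diagonal_eq_sum` and the completeness
★ `sum_J_smul_vecMulVec_matCol_eq_one` give, for `x = g·t·g⁻¹`, ROW 2 of `x − z₂·1` through the two POSITIVE columns only:
  **`(x − z₂·1)₂ⱼ = ((z₀−z₂)·g₂₀·conj(g_{j0}) + (z₁−z₂)·g₂₁·conj(g_{j1}))·J_{jj}`**  (§1).
Put `a = (z₀−z₂)g₂₀`, `b = (z₁−z₂)g₂₁`; the row is `J_{jj}·conj(w_j)` with `w = conj(a)·c₀ + conj(b)·c₁`, and the `J`-norm of `w` is `|a|² + |b|²` (`c_p* J c_q = J_{pq}` ★).  Hence the SIGNATURE-(2,1)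
PYTHAGORAS of row 2 (§2):
  **`|x₂₀|² + |x₂₁|² − |x₂₂ − z₂|² = |z₀−z₂|²·|g₂₀|² + |z₁−z₂|²·|g₂₁|²`**,
and with ★ `|g₂₀|² + |g₂₁|² = |g₂₂|² − 1` (§3):
  **`(|g₂₂|² − 1)·min(|z₂−z₀|,|z₂−z₁|)² ≤ |x₂₀|² + |x₂₁|²`** — NO regime hypothesis.
So a bound `|x₂₀|, |x₂₁| ≤ R` on the support of the test function confines `g` to `|g₂₂|² ≤ 1 + 2R²∕m²`, `m = min(|z₂−z₀|,|z₂−z₁|)` (the two NONCOMPACT root differences = Warner's `π_SI`), i.e. the base point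
`g • x₀` to the sub-ball `1 − |g•x₀|² ≥ (1 + 2R²∕m²)⁻¹` (§4) — in the S chambers as well as in the D regime (where ★ p844013 gets exponent 1 from the corner entry ALONE; ★ p844013's remark «no such
bound holds in S» concerns the corner entry, whose weights cancel there — the OFF-diagonal entries of row 2 do not cancel).  This is the `U(2,1)` instance of Harish-Chandra's compactness-with-polynomial-loss
lemma `‖x‖·|π_SI(H)|^r ≤ S·‖Ad(x)H‖^s` for the fundamental Cartan (Warner II, Appendix to 8.4.3, Lemma 2), with `r = 2` per root.
HONEST LABEL: HC_CM is proved only modulo the printed citations until rung 0 closes; elementary inequalities over ★ (β-0), pays nothing by itself.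

## References
* [WarnerHASSLG2] G. Warner, *Harmonic Analysis on Semi-Simple Lie Groups II*, Grundlehren 189 (1972), §8.4.3 Appendix, Lemma 2; Thm. 8.4.3.1.
* [Rogawski1990] J. D. Rogawski, *Automorphic Representations of Unitary Groups in Three Variables*, Ann. of Math. Stud. 123 (1990), §8.4 pp. 126–127.
* [Goldman1999] W. M. Goldman, *Complex Hyperbolic Geometry* (1999), §3.1.1 (negative∕positive vectors, `|g₂₂|² = cosh² r`).
-/

set_option autoImplicit false

noncomputable section

open Matrix Complex ComplexConjugate MulAction

namespace Literature.Geometry.ComplexHyperbolic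

namespace BallModel

/-! ## §1 Row 2 of `g·t·g⁻¹ − z₂·1` through the two positive columns -/

section Row

/-- **ROW 2, spectral form**: `(g·diag z·g⁻¹)₂ⱼ = Σ_p z_p J_{pp} · g₂ₚ·conj(g_{jp})·J_{jj}` (★ `mat_conj_diagonal_eq_sum`). [cite: Goldman1999, §3.1.1] -/
theorem mat_conj_diagonal_apply_two_eq_sum (g : U21) (z : Fin 3 → Circle)
    (hz : (Matrix.diagonal fun i => (z i : ℂ))ᴴ * J * Matrix.diagonal (fun i => (z i : ℂ)) = J) (j : Fin 3) :
    mat (g * mkU21 (Matrix.diagonal fun i => (z i : ℂ)) hz * g⁻¹) 2 j =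
      ∑ p : Fin 3, (z p : ℂ) * J p p * (mat g 2 p * conj (mat g j p) * J j j) := by
  rw [mat_conj_diagonal_eq_sum, Matrix.sum_apply]
  refine Finset.sum_congr rfl fun p _ => ?_
  rw [Matrix.smul_apply, smul_eq_mul, vecMulVec_star_mul_J_apply]

/-- Row 2 of the identity, spectral form: `δ₂ⱼ = Σ_p J_{pp} · g₂ₚ·conj(g_{jp})·J_{jj}` (★ completeness `Σ_p J_{pp} N(c_p) = 1`). [cite: Goldman1999, §3.1.1] -/
theorem one_apply_two_eq_sum (g : U21) (j : Fin 3) :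
    (1 : Matrix (Fin 3) (Fin 3) ℂ) 2 j = ∑ p : Fin 3, J p p * (mat g 2 p * conj (mat g j p) * J j j) := by
  rw [← sum_J_smul_vecMulVec_matCol_eq_one g, Matrix.sum_apply]
  refine Finset.sum_congr rfl fun p _ => ?_
  rw [Matrix.smul_apply, smul_eq_mul, vecMulVec_star_mul_J_apply]

/-- **ROW 2 OF `x − z₂·1` THROUGH THE POSITIVE COLUMNS**: for `x = g·diag z·g⁻¹`,
`x₂ⱼ − z₂·δ₂ⱼ = ((z₀−z₂)·g₂₀·conj(g_{j0}) + (z₁−z₂)·g₂₁·conj(g_{j1}))·J_{jj}` — the column through the negative line drops out. [cite: Goldman1999, §3.1.1] [cite: Rogawski1990, §8.4 pp. 126–127] -/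
theorem mat_conj_diagonal_apply_two_sub (g : U21) (z : Fin 3 → Circle)
    (hz : (Matrix.diagonal fun i => (z i : ℂ))ᴴ * J * Matrix.diagonal (fun i => (z i : ℂ)) = J) (j : Fin 3) :
    mat (g * mkU21 (Matrix.diagonal fun i => (z i : ℂ)) hz * g⁻¹) 2 j - (z 2 : ℂ) * (1 : Matrix (Fin 3) (Fin 3) ℂ) 2 j =
      (((z 0 : ℂ) - z 2) * mat g 2 0 * conj (mat g j 0) + ((z 1 : ℂ) - z 2) * mat g 2 1 * conj (mat g j 1)) * J j j := by
  rw [mat_conj_diagonal_apply_two_eq_sum, one_apply_two_eq_sum g j, Fin.sum_univ_three, Fin.sum_univ_three, J_apply_00, J_apply_11, J_apply_22]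
  ring

/-- The off-diagonal entries of row 2: `x₂₀ = ((z₀−z₂)·g₂₀·conj(g₀₀) + (z₁−z₂)·g₂₁·conj(g₀₁))`. [cite: Goldman1999, §3.1.1] -/
theorem mat_conj_diagonal_apply_two_zero (g : U21) (z : Fin 3 → Circle)
    (hz : (Matrix.diagonal fun i => (z i : ℂ))ᴴ * J * Matrix.diagonal (fun i => (z i : ℂ)) = J) :
    mat (g * mkU21 (Matrix.diagonal fun i => (z i : ℂ)) hz * g⁻¹) 2 0 =
      ((z 0 : ℂ) - z 2) * mat g 2 0 * conj (mat g 0 0) + ((z 1 : ℂ) - z 2) * mat g 2 1 * conj (mat g 0 1) := by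
  have h := mat_conj_diagonal_apply_two_sub g z hz 0
  rw [Matrix.one_apply_ne (by decide : (2 : Fin 3) ≠ 0), mul_zero, sub_zero, J_apply_00, mul_one] at h
  exact h

/-- The off-diagonal entries of row 2: `x₂₁ = ((z₀−z₂)·g₂₀·conj(g₁₀) + (z₁−z₂)·g₂₁·conj(g₁₁))`. [cite: Goldman1999, §3.1.1] -/
theorem mat_conj_diagonal_apply_two_one (g : U21) (z : Fin 3 → Circle)
    (hz : (Matrix.diagonal fun i => (z i : ℂ))ᴴ * J * Matrix.diagonal (fun i => (z i : ℂ)) = J) :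
    mat (g * mkU21 (Matrix.diagonal fun i => (z i : ℂ)) hz * g⁻¹) 2 1 =
      ((z 0 : ℂ) - z 2) * mat g 2 0 * conj (mat g 1 0) + ((z 1 : ℂ) - z 2) * mat g 2 1 * conj (mat g 1 1) := by
  have h := mat_conj_diagonal_apply_two_sub g z hz 1
  rw [Matrix.one_apply_ne (by decide : (2 : Fin 3) ≠ 1), mul_zero, sub_zero, J_apply_11, mul_one] at h
  exact h

/-- The corner entry of row 2 recentred: `x₂₂ − z₂ = −((z₀−z₂)·|g₂₀|² + (z₁−z₂)·|g₂₁|²)` (= ★ `mat_conj_diagonal_apply_two_two_eq`, recentred form). [cite: Goldman1999, §3.1.1] -/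
theorem mat_conj_diagonal_apply_two_two_sub (g : U21) (z : Fin 3 → Circle)
    (hz : (Matrix.diagonal fun i => (z i : ℂ))ᴴ * J * Matrix.diagonal (fun i => (z i : ℂ)) = J) :
    mat (g * mkU21 (Matrix.diagonal fun i => (z i : ℂ)) hz * g⁻¹) 2 2 - (z 2 : ℂ) =
      -(((z 0 : ℂ) - z 2) * (‖mat g 2 0‖ ^ 2 : ℝ) + ((z 1 : ℂ) - z 2) * (‖mat g 2 1‖ ^ 2 : ℝ)) := by
  have h := mat_conj_diagonal_apply_two_sub g z hz 2
  rw [Matrix.one_apply_eq, mul_one, J_apply_22] at h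
  rw [h]
  simp only [mul_assoc, Complex.mul_conj']
  push_cast
  ring

end Row

/-! ## §2 The signature-(2,1) Pythagoras of row 2 -/

section Pythagoras

/-- `|α·u + β·v|² = |α|²|u|² + |β|²|v|² + 2·Re(α·β̄·u·v̄)` in `ℂ`. [folklore] -/
private theorem norm_sq_mul_add_mul (α β u v : ℂ) :
    ‖α * u + β * v‖ ^ 2 = ‖α‖ ^ 2 * ‖u‖ ^ 2 + ‖β‖ ^ 2 * ‖v‖ ^ 2 + 2 * (α * conj β * (u * conj v)).re := by
  simp only [Complex.sq_norm, Complex.normSq_apply, Complex.add_re, Complex.add_im, Complex.mul_re, Complex.mul_im, Complex.conj_re, Complex.conj_im]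
  ring

/-- The columns `0, 1` of `g ∈ U(2,1)` are `J`-orthogonal: `g₀₀·conj(g₀₁) + g₁₀·conj(g₁₁) − g₂₀·conj(g₂₁) = 0` (entry `(1,0)` of `gᴴ J g = J`). [cite: Goldman1999, §3.1.1] -/
theorem matCol_zero_J_orthogonal_matCol_one (g : U21) :
    mat g 0 0 * conj (mat g 0 1) + mat g 1 0 * conj (mat g 1 1) - mat g 2 0 * conj (mat g 2 1) = 0 := by
  have h := congrFun (congrFun (mat_mem g) 1) 0
  rw [J_apply_of_ne (by decide : (1 : Fin 3) ≠ 0)] at h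
  simp only [Matrix.mul_apply, Fin.sum_univ_three, Matrix.conjTranspose_apply, Complex.star_def, J_apply_00, J_apply_11, J_apply_22,
    J_apply_of_ne (by decide : (0 : Fin 3) ≠ 1), J_apply_of_ne (by decide : (0 : Fin 3) ≠ 2), J_apply_of_ne (by decide : (1 : Fin 3) ≠ 0),
    J_apply_of_ne (by decide : (1 : Fin 3) ≠ 2), J_apply_of_ne (by decide : (2 : Fin 3) ≠ 0), J_apply_of_ne (by decide : (2 : Fin 3) ≠ 1)] at h
  linear_combination h

/-- The `J`-norm of a combination of the two POSITIVE columns: `Σ_j J_{jj}·|α·g_{j0} + β·g_{j1}|² = |α|² + |β|²` (`c₀, c₁` are `J`-orthonormal: ★ `col_identity`, ★ `mat_mem`).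
[cite: Goldman1999, §3.1.1] -/
theorem sum_J_mul_norm_sq_col_combination (g : U21) (α β : ℂ) :
    ‖α * mat g 0 0 + β * mat g 0 1‖ ^ 2 + ‖α * mat g 1 0 + β * mat g 1 1‖ ^ 2 - ‖α * mat g 2 0 + β * mat g 2 1‖ ^ 2 = ‖α‖ ^ 2 + ‖β‖ ^ 2 := by
  have hc0 : ‖mat g 0 0‖ ^ 2 + ‖mat g 1 0‖ ^ 2 - ‖mat g 2 0‖ ^ 2 = 1 := by simpa using col_identity g 0
  have hc1 : ‖mat g 0 1‖ ^ 2 + ‖mat g 1 1‖ ^ 2 - ‖mat g 2 1‖ ^ 2 = 1 := by simpa using col_identity g 1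
  have hS := matCol_zero_J_orthogonal_matCol_one g
  have hre : (α * conj β * (mat g 0 0 * conj (mat g 0 1))).re + (α * conj β * (mat g 1 0 * conj (mat g 1 1))).re
      - (α * conj β * (mat g 2 0 * conj (mat g 2 1))).re = 0 := by
    rw [← Complex.add_re, ← Complex.sub_re, ← mul_add, ← mul_sub, hS, mul_zero, Complex.zero_re]
  rw [norm_sq_mul_add_mul, norm_sq_mul_add_mul, norm_sq_mul_add_mul]
  linear_combination ‖α‖ ^ 2 * hc0 + ‖β‖ ^ 2 * hc1 + 2 * hre

/-- **THE SIGNATURE-(2,1) PYTHAGORAS OF ROW 2**: for `g ∈ U(2,1)`, `t = diag(z₀,z₁,z₂)`, `x = g·t·g⁻¹`: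
`|x₂₀|² + |x₂₁|² − |x₂₂ − z₂|² = |z₀−z₂|²·|g₂₀|² + |z₁−z₂|²·|g₂₁|²` — the `J`-norm of row 2 of `x − z₂·1` is a NON-NEGATIVE combination of the two noncompact root differences, in every regime.
[cite: WarnerHASSLG2, §8.4.3 Appendix Lemma 2] [cite: Goldman1999, §3.1.1] -/
theorem norm_sq_row_two_signature (g : U21) (z : Fin 3 → Circle)
    (hz : (Matrix.diagonal fun i => (z i : ℂ))ᴴ * J * Matrix.diagonal (fun i => (z i : ℂ)) = J) :
    ‖mat (g * mkU21 (Matrix.diagonal fun i => (z i : ℂ)) hz * g⁻¹) 2 0‖ ^ 2 + ‖mat (g * mkU21 (Matrix.diagonal fun i => (z i : ℂ)) hz * g⁻¹) 2 1‖ ^ 2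
        - ‖mat (g * mkU21 (Matrix.diagonal fun i => (z i : ℂ)) hz * g⁻¹) 2 2 - (z 2 : ℂ)‖ ^ 2 =
      ‖(z 0 : ℂ) - z 2‖ ^ 2 * ‖mat g 2 0‖ ^ 2 + ‖(z 1 : ℂ) - z 2‖ ^ 2 * ‖mat g 2 1‖ ^ 2 := by
  -- the row is `conj` of a combination of the columns `0, 1` with coefficients `conj a`, `conj b` (`a = (z₀−z₂)g₂₀`, `b = (z₁−z₂)g₂₁`), up to the signs `J_{jj}`
  have h0 : mat (g * mkU21 (Matrix.diagonal fun i => (z i : ℂ)) hz * g⁻¹) 2 0 =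
      conj (conj (((z 0 : ℂ) - z 2) * mat g 2 0) * mat g 0 0 + conj (((z 1 : ℂ) - z 2) * mat g 2 1) * mat g 0 1) := by
    rw [mat_conj_diagonal_apply_two_zero]
    simp only [map_add, map_mul, map_sub, Complex.conj_conj]
  have h1 : mat (g * mkU21 (Matrix.diagonal fun i => (z i : ℂ)) hz * g⁻¹) 2 1 =
      conj (conj (((z 0 : ℂ) - z 2) * mat g 2 0) * mat g 1 0 + conj (((z 1 : ℂ) - z 2) * mat g 2 1) * mat g 1 1) := by
    rw [mat_conj_diagonal_apply_two_one]
    simp only [map_add, map_mul, map_sub, Complex.conj_conj]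
  have h2 : mat (g * mkU21 (Matrix.diagonal fun i => (z i : ℂ)) hz * g⁻¹) 2 2 - (z 2 : ℂ) =
      -conj (conj (((z 0 : ℂ) - z 2) * mat g 2 0) * mat g 2 0 + conj (((z 1 : ℂ) - z 2) * mat g 2 1) * mat g 2 1) := by
    rw [mat_conj_diagonal_apply_two_two_sub]
    simp only [map_add, map_mul, map_sub, Complex.conj_conj]
    have e0 : ((‖mat g 2 0‖ ^ 2 : ℝ) : ℂ) = mat g 2 0 * conj (mat g 2 0) := by rw [Complex.mul_conj']; push_cast; ring
    have e1 : ((‖mat g 2 1‖ ^ 2 : ℝ) : ℂ) = mat g 2 1 * conj (mat g 2 1) := by rw [Complex.mul_conj']; push_cast; ring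
    rw [e0, e1]
    ring
  rw [h0, h1, h2, norm_neg, Complex.norm_conj, Complex.norm_conj, Complex.norm_conj, sum_J_mul_norm_sq_col_combination,
    Complex.norm_conj, Complex.norm_conj, norm_mul, norm_mul, mul_pow, mul_pow]

end Pythagoras

/-! ## §3 The support bound in all regimes -/

section Inequality

/-- **THE ONE-LEVEL SUPPORT BOUND, ALL REGIMES**: for `g ∈ U(2,1)`, `t = diag(z₀,z₁,z₂)`, `x = g·t·g⁻¹`:
`(|g₂₂|² − 1)·min(|z₂−z₀|,|z₂−z₁|)² ≤ |x₂₀|² + |x₂₁|²` — the off-diagonal entries of row 2 ALONE confine `g • x₀` to a sub-ball, uniformly over the fibre and WITHOUT the D-regime hypothesis of ★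
`norm_22_sq_sub_one_mul_min_le` (Harish-Chandra's compactness lemma with polynomial loss `|π_SI|⁻²` for the fundamental Cartan of `U(2,1)`).
[cite: WarnerHASSLG2, §8.4.3 Appendix Lemma 2] [cite: Rogawski1990, §8.4 pp. 126–127] -/
theorem norm_22_sq_sub_one_mul_min_sq_le (g : U21) (z : Fin 3 → Circle)
    (hz : (Matrix.diagonal fun i => (z i : ℂ))ᴴ * J * Matrix.diagonal (fun i => (z i : ℂ)) = J) :
    (‖mat g 2 2‖ ^ 2 - 1) * (min ‖(z 2 : ℂ) - z 0‖ ‖(z 2 : ℂ) - z 1‖) ^ 2 ≤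
      ‖mat (g * mkU21 (Matrix.diagonal fun i => (z i : ℂ)) hz * g⁻¹) 2 0‖ ^ 2 + ‖mat (g * mkU21 (Matrix.diagonal fun i => (z i : ℂ)) hz * g⁻¹) 2 1‖ ^ 2 := by
  have hP := norm_sq_row_two_signature g z hz
  have hrow := norm_sq_two_zero_add_norm_sq_two_one g
  set m : ℝ := min ‖(z 2 : ℂ) - z 0‖ ‖(z 2 : ℂ) - z 1‖ with hm
  have hm0 : 0 ≤ m := le_min (norm_nonneg _) (norm_nonneg _)
  have hma : m ^ 2 ≤ ‖(z 0 : ℂ) - z 2‖ ^ 2 := by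
    rw [norm_sub_rev]; exact pow_le_pow_left₀ hm0 (min_le_left _ _) 2
  have hmb : m ^ 2 ≤ ‖(z 1 : ℂ) - z 2‖ ^ 2 := by
    rw [norm_sub_rev]; exact pow_le_pow_left₀ hm0 (min_le_right _ _) 2
  have h1 : m ^ 2 * ‖mat g 2 0‖ ^ 2 ≤ ‖(z 0 : ℂ) - z 2‖ ^ 2 * ‖mat g 2 0‖ ^ 2 := mul_le_mul_of_nonneg_right hma (sq_nonneg _)
  have h2 : m ^ 2 * ‖mat g 2 1‖ ^ 2 ≤ ‖(z 1 : ℂ) - z 2‖ ^ 2 * ‖mat g 2 1‖ ^ 2 := mul_le_mul_of_nonneg_right hmb (sq_nonneg _)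
  nlinarith [h1, h2, hP, hrow, sq_nonneg ‖mat (g * mkU21 (Matrix.diagonal fun i => (z i : ℂ)) hz * g⁻¹) 2 2 - (z 2 : ℂ)‖]

end Inequality

/-! ## §4 Consequences: `|g₂₂|` and the base point `g • x₀` are confined, in every chamber -/

section Confinement

/-- **`|g₂₂|² ≤ 1 + 2R²∕m²` IN ALL REGIMES**: if `|x₂₀|, |x₂₁| ≤ R` (`x = g·t·g⁻¹`) and `0 < m ≤ min(|z₂−z₀|,|z₂−z₁|)`, then `|g₂₂|² ≤ 1 + 2R²∕m²`.
[cite: WarnerHASSLG2, §8.4.3 Appendix Lemma 2] [cite: Goldman1999, §3.1.1] -/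
theorem norm_22_sq_le_of_row_le (g : U21) (z : Fin 3 → Circle)
    (hz : (Matrix.diagonal fun i => (z i : ℂ))ᴴ * J * Matrix.diagonal (fun i => (z i : ℂ)) = J) {m R : ℝ} (hm : 0 < m)
    (hmle : m ≤ min ‖(z 2 : ℂ) - z 0‖ ‖(z 2 : ℂ) - z 1‖)
    (hR0 : ‖mat (g * mkU21 (Matrix.diagonal fun i => (z i : ℂ)) hz * g⁻¹) 2 0‖ ≤ R) (hR1 : ‖mat (g * mkU21 (Matrix.diagonal fun i => (z i : ℂ)) hz * g⁻¹) 2 1‖ ≤ R) :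
    ‖mat g 2 2‖ ^ 2 ≤ 1 + 2 * R ^ 2 / m ^ 2 := by
  have h := norm_22_sq_sub_one_mul_min_sq_le g z hz
  have hpos : 0 ≤ ‖mat g 2 2‖ ^ 2 - 1 := by nlinarith [one_le_norm_22 g, norm_nonneg (mat g 2 2)]
  have hR : 0 ≤ R := le_trans (norm_nonneg _) hR0
  have hsq0 : ‖mat (g * mkU21 (Matrix.diagonal fun i => (z i : ℂ)) hz * g⁻¹) 2 0‖ ^ 2 ≤ R ^ 2 := pow_le_pow_left₀ (norm_nonneg _) hR0 2
  have hsq1 : ‖mat (g * mkU21 (Matrix.diagonal fun i => (z i : ℂ)) hz * g⁻¹) 2 1‖ ^ 2 ≤ R ^ 2 := pow_le_pow_left₀ (norm_nonneg _) hR1 2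
  have hmm : m ^ 2 ≤ (min ‖(z 2 : ℂ) - z 0‖ ‖(z 2 : ℂ) - z 1‖) ^ 2 := pow_le_pow_left₀ hm.le hmle 2
  have h1 : (‖mat g 2 2‖ ^ 2 - 1) * m ^ 2 ≤ 2 * R ^ 2 :=
    le_trans (mul_le_mul_of_nonneg_left hmm hpos) (le_trans h (by linarith))
  have hm2 : 0 < m ^ 2 := pow_pos hm 2
  have h2 : ‖mat g 2 2‖ ^ 2 - 1 ≤ 2 * R ^ 2 / m ^ 2 := (le_div_iff₀ hm2).2 h1
  linarith

/-- **THE BASE POINT STAYS IN A SUB-BALL, ALL REGIMES**: under the same hypotheses `1 − |g•x₀|² ≥ (1 + 2R²∕m²)⁻¹` (★ `one_sub_nsq_smul_x₀`). [cite: Rudin1980, Thm 2.2.2] [cite: WarnerHASSLG2, §8.4.3 Appendix Lemma 2] -/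
theorem one_div_le_one_sub_nsq_smul_x₀_of_row_le (g : U21) (z : Fin 3 → Circle)
    (hz : (Matrix.diagonal fun i => (z i : ℂ))ᴴ * J * Matrix.diagonal (fun i => (z i : ℂ)) = J) {m R : ℝ} (hm : 0 < m)
    (hmle : m ≤ min ‖(z 2 : ℂ) - z 0‖ ‖(z 2 : ℂ) - z 1‖)
    (hR0 : ‖mat (g * mkU21 (Matrix.diagonal fun i => (z i : ℂ)) hz * g⁻¹) 2 0‖ ≤ R) (hR1 : ‖mat (g * mkU21 (Matrix.diagonal fun i => (z i : ℂ)) hz * g⁻¹) 2 1‖ ≤ R) :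
    1 / (1 + 2 * R ^ 2 / m ^ 2) ≤ 1 - nsq (g • x₀).1 := by
  have hsq := norm_22_sq_le_of_row_le g z hz hm hmle hR0 hR1
  have hpos : 0 < ‖mat g 2 2‖ ^ 2 := pow_pos (norm_22_pos g) 2
  rw [one_sub_nsq_smul_x₀]
  exact one_div_le_one_div_of_le hpos hsq

/-- **ALL-REGIME CONFINEMENT FROM A BOUND ON THE WHOLE CONJUGATE**: if every entry of `x = g·t·g⁻¹` has norm `≤ R` (e.g. `x` lies in a fixed compact set, as on the support of a compactly supported
test function) and `0 < m ≤ min(|z₂−z₀|,|z₂−z₁|)`, then `|g₂₂|² ≤ 1 + 2R²∕m²` — the form the crude jet bound (design v2 (c3′)) consumes. [cite: WarnerHASSLG2, §8.4.3 Appendix Lemma 2; Thm. 8.4.3.1] -/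
theorem norm_22_sq_le_of_entries_le (g : U21) (z : Fin 3 → Circle)
    (hz : (Matrix.diagonal fun i => (z i : ℂ))ᴴ * J * Matrix.diagonal (fun i => (z i : ℂ)) = J) {m R : ℝ} (hm : 0 < m)
    (hmle : m ≤ min ‖(z 2 : ℂ) - z 0‖ ‖(z 2 : ℂ) - z 1‖)
    (hR : ∀ i j : Fin 3, ‖mat (g * mkU21 (Matrix.diagonal fun i => (z i : ℂ)) hz * g⁻¹) i j‖ ≤ R) :
    ‖mat g 2 2‖ ^ 2 ≤ 1 + 2 * R ^ 2 / m ^ 2 :=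
  norm_22_sq_le_of_row_le g z hz hm hmle (hR 2 0) (hR 2 1)

end Confinement

end BallModel

end Literature.Geometry.ComplexHyperbolic

end
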